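import Summits.NavierStokesRegularity.NavierStokesRegularity.Theorems.AdaptedFrequencyTangentFlowTransferKernelCalculusGlobal
import Summits.NavierStokesRegularity.NavierStokesRegularity.Theorems.AdaptedFrequencyEnstrophyDensityBounds
import Summits.NavierStokesRegularity.NavierStokesRegularity.Theorems.AdaptedFrequencyTangentFlowTransferWindowRegularity
import Summits.NavierStokesRegularity.NavierStokesRegularity.Theorems.AdaptedFrequencyTangentFlowTransferConcentration
import Literature.Analysis.FluidPDE.VectorCalculus
import HarnessLib

/-!
# Tools for the transfer of the adapted frequency to the limit of the blow-up sequence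
# (route `AdaptedFrequency`, item `TangentFlowTransfer`, stmt-NavierStokesRegularity-10494)

Helper file (all results proved); consumed by `AdaptedFrequencyTangentFlowTransferFrequencyTransfer`
(step (S8b) of the transfer, `adaptedFrequency_limit_eq`). On a window `U = (2τ, τ/2)`, `τ < 0`:

* one integrable Gaussian dominating all kernels `g_k(t)`, `t ∈ U`
  (`gaussian_le_gaussian_of_mem_Ioo`, `integrable_gaussian_dom`);
* pointwise continuity/convergence of the spatial expression
  `L‖ω‖² = 2⟪ω, Du ω⟫ − 2ν|Dω|²` in `(Du, D²u)` (`tendsto_opLDensity`, `tendsto_fderiv_curl`);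
* `H′ = ∫ (L‖ω‖²) G` for the adapted enstrophy of a bounded classical solution against a dominated
  adapted kernel, with the uniform bound `|H′| ≤ B + B² + |ν|B`
  (`hasDerivAt_adaptedEnstrophy_window`, `abs_integral_opLDensity_mul_le`);
* dominated convergence for `H_k` and `H_k′` (`tendsto_adaptedEnstrophy_of_tendsto`,
  `tendsto_integral_opLDensity_of_tendsto`) and continuity of the limit derivative
  (`continuousOn_integral_opLDensity`).
-/

noncomputable section

open MeasureTheory Set Function Filter TopologicalSpace Metric
open scoped Topology InnerProductSpace RealInnerProductSpace Laplacian

namespace Summit.NavierStokesRegularity.NavierStokesRegularity.Theorems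

open Literature.Analysis Literature.Analysis.FluidPDE

local notation "ℝ³" => EuclideanSpace ℝ (Fin 3)

/-! ### One Gaussian dominating the kernels on `U = (2τ, τ/2)` -/

/-- On `t ∈ (2τ, τ/2)` (`τ < 0`) the Gaussian `C₁ (−t)^{-3/2} e^{−‖x‖²/(C₂(−t))}` is dominated by
the fixed Gaussian `C₁ (−τ/2)^{-3/2} e^{−‖x‖²/((4C₂)(−τ/2))}`. [folklore] -/
theorem gaussian_le_gaussian_of_mem_Ioo {C₁ C₂ τ : ℝ} (hC₁ : 0 ≤ C₁) (hC₂ : 0 < C₂) (hτ : τ < 0)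
    {t : ℝ} (ht : t ∈ Ioo (2 * τ) (τ / 2)) (x : ℝ³) :
    C₁ * ((0:ℝ) - t) ^ (-(3:ℝ) / 2) * Real.exp (-(‖x - (0 : ℝ³)‖ ^ 2) / (C₂ * ((0:ℝ) - t))) ≤
      C₁ * ((0:ℝ) - τ / 2) ^ (-(3:ℝ) / 2) *
        Real.exp (-(‖x - (0 : ℝ³)‖ ^ 2) / ((4 * C₂) * ((0:ℝ) - τ / 2))) := by
  have h1 : (0:ℝ) - τ / 2 ≤ 0 - t := by linarith [ht.2]
  have h2 : 0 < (0:ℝ) - τ / 2 := by linarith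
  have h3 : ((0:ℝ) - t) ^ (-(3:ℝ) / 2) ≤ ((0:ℝ) - τ / 2) ^ (-(3:ℝ) / 2) :=
    Real.rpow_le_rpow_of_nonpos h2 h1 (by norm_num)
  have h4 : Real.exp (-(‖x - (0 : ℝ³)‖ ^ 2) / (C₂ * ((0:ℝ) - t))) ≤
      Real.exp (-(‖x - (0 : ℝ³)‖ ^ 2) / ((4 * C₂) * ((0:ℝ) - τ / 2))) := by
    rw [Real.exp_le_exp, neg_div, neg_div, neg_le_neg_iff]
    have h5 : C₂ * ((0:ℝ) - t) ≤ (4 * C₂) * ((0:ℝ) - τ / 2) := by nlinarith [ht.1]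
    exact div_le_div_of_nonneg_left (sq_nonneg _) (mul_pos hC₂ (by linarith [ht.2])) h5
  have h6 : 0 ≤ Real.exp (-(‖x - (0 : ℝ³)‖ ^ 2) / (C₂ * ((0:ℝ) - t))) := (Real.exp_pos _).le
  calc C₁ * ((0:ℝ) - t) ^ (-(3:ℝ) / 2) * Real.exp (-(‖x - (0 : ℝ³)‖ ^ 2) / (C₂ * ((0:ℝ) - t)))
      ≤ C₁ * ((0:ℝ) - τ / 2) ^ (-(3:ℝ) / 2) * Real.exp (-(‖x - (0 : ℝ³)‖ ^ 2) / (C₂ * ((0:ℝ) - t))) := by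
        gcongr
    _ ≤ _ := by
        refine mul_le_mul_of_nonneg_left h4 (mul_nonneg hC₁ (Real.rpow_nonneg h2.le _))

/-- The dominating Gaussian is integrable (it is a multiple of a heat kernel). [folklore] -/
theorem integrable_gaussian_dom {C₁ C₂ τ : ℝ} (hC₂ : 0 < C₂) (hτ : τ < 0) :
    Integrable (fun x : ℝ³ => C₁ * ((0:ℝ) - τ / 2) ^ (-(3:ℝ) / 2) *
      Real.exp (-(‖x - (0 : ℝ³)‖ ^ 2) / ((4 * C₂) * ((0:ℝ) - τ / 2)))) (volume : Measure ℝ³) := by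
  have h3 : ((Module.finrank ℝ ℝ³ : ℕ) : ℝ) = 3 := by rw [finrank_euclideanSpace_fin]; norm_num
  have hτ2 : τ / 2 < 0 := by linarith
  have h := (integrable_backwardHeatKernel (E := ℝ³) (ν := (4 * C₂) / 4) (T := 0) (t := τ / 2)
    (by positivity) hτ2 (0 : ℝ³)).const_mul (C₁ * (Real.pi * (4 * C₂)) ^ ((3 : ℝ) / 2))
  refine h.congr (Eventually.of_forall fun x => ?_)
  have e := gaussian_eq_const_mul_backwardHeatKernel (E := ℝ³) (T := 0) hτ2 (0 : ℝ³) x C₁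
    (C₂ := 4 * C₂) (by positivity)
  rw [h3] at e
  simp only
  rw [e]

/-! ### Continuity of the spatial expression `L‖ω‖² = 2⟪ω, Du ω⟫ − 2ν|Dω|²` in its arguments -/

/-- The Frobenius norm square is continuous on `E →L F`. [folklore] -/
theorem continuous_frobeniusNormSq {E F : Type*} [NormedAddCommGroup E] [InnerProductSpace ℝ E]
    [FiniteDimensional ℝ E] [NormedAddCommGroup F] [InnerProductSpace ℝ F] :
    Continuous (frobeniusNormSq : (E →L[ℝ] F) → ℝ) := by
  unfold frobeniusNormSq
  refine continuous_finsetSum _ fun i _ => ?_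
  exact ((ContinuousLinearMap.apply ℝ F (stdOrthonormalBasis ℝ E i)).continuous.norm).pow 2

/-- `D(curl v_k)(x) → D(curl V)(x)` when `D²v_k(x) → D²V(x)` (`D curl = curlCLM ∘ D²`). [folklore] -/
theorem tendsto_fderiv_curl {v : ℕ → ℝ³ → ℝ³} {V : ℝ³ → ℝ³} (hv : ∀ k, ContDiff ℝ 2 (v k))
    (hV : ContDiff ℝ 2 V) {x : ℝ³}
    (h2 : Tendsto (fun k => fderiv ℝ (fderiv ℝ (v k)) x) atTop (𝓝 (fderiv ℝ (fderiv ℝ V) x))) :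
    Tendsto (fun k => fderiv ℝ (curl (v k)) x) atTop (𝓝 (fderiv ℝ (curl V) x)) := by
  have e1 : ∀ k, fderiv ℝ (curl (v k)) x = curlCLM.comp (fderiv ℝ (fderiv ℝ (v k)) x) :=
    fun k => fderiv_curl (hv k) x
  have e2 : fderiv ℝ (curl V) x = curlCLM.comp (fderiv ℝ (fderiv ℝ V) x) := fderiv_curl hV x
  simp only [e1, e2]
  exact (((ContinuousLinearMap.compL ℝ ℝ³ (ℝ³ →L[ℝ] ℝ³) ℝ³) curlCLM).continuous.tendsto _).comp h2

/-- **Pointwise convergence of `L‖ω‖²`.** If `D(v_k)(x) → D(v)(x)` and `D²(v_k)(x) → D²(v)(x)`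
(as `fderiv ∘ fderiv`), all fields `C²`, then
`2⟪curl v_k, Dv_k curl v_k⟫ − 2ν|D curl v_k|² → 2⟪curl v, Dv curl v⟫ − 2ν|D curl v|²` at `x`.
[folklore] -/
theorem tendsto_opLDensity {v : ℕ → ℝ³ → ℝ³} {V : ℝ³ → ℝ³} (hv : ∀ k, ContDiff ℝ 2 (v k))
    (hV : ContDiff ℝ 2 V) {x : ℝ³}
    (h1 : Tendsto (fun k => fderiv ℝ (v k) x) atTop (𝓝 (fderiv ℝ V x)))
    (h2 : Tendsto (fun k => fderiv ℝ (fderiv ℝ (v k)) x) atTop (𝓝 (fderiv ℝ (fderiv ℝ V) x)))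
    (ν : ℝ) :
    Tendsto (fun k => 2 * ⟪curl (v k) x, fderiv ℝ (v k) x (curl (v k) x)⟫ -
        2 * ν * frobeniusNormSq (fderiv ℝ (curl (v k)) x)) atTop
      (𝓝 (2 * ⟪curl V x, fderiv ℝ V x (curl V x)⟫ - 2 * ν * frobeniusNormSq (fderiv ℝ (curl V) x))) := by
  -- `curl = curlCLM ∘ D`
  have hc : Tendsto (fun k => curl (v k) x) atTop (𝓝 (curl V x)) := by
    simp only [curl_eq_curlCLM]
    exact (curlCLM.continuous.tendsto _).comp h1
  -- `Dv_k (curl v_k) → DV (curl V)` (evaluation is jointly continuous)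
  have happ : Tendsto (fun k => fderiv ℝ (v k) x (curl (v k) x)) atTop (𝓝 (fderiv ℝ V x (curl V x))) := by
    have hcont : Continuous fun p : (ℝ³ →L[ℝ] ℝ³) × ℝ³ => p.1 p.2 :=
      isBoundedBilinearMap_apply.continuous
    exact (hcont.tendsto (fderiv ℝ V x, curl V x)).comp (h1.prodMk_nhds hc)
  have hinner : Tendsto (fun k => ⟪curl (v k) x, fderiv ℝ (v k) x (curl (v k) x)⟫) atTop
      (𝓝 ⟪curl V x, fderiv ℝ V x (curl V x)⟫) := hc.inner happ
  -- `D(curl v_k) = curlCLM ∘ D²v_k → curlCLM ∘ D²V`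
  have hD : Tendsto (fun k => fderiv ℝ (curl (v k)) x) atTop (𝓝 (fderiv ℝ (curl V) x)) :=
    tendsto_fderiv_curl hv hV h2
  have hfrob : Tendsto (fun k => frobeniusNormSq (fderiv ℝ (curl (v k)) x)) atTop
      (𝓝 (frobeniusNormSq (fderiv ℝ (curl V) x))) :=
    (continuous_frobeniusNormSq.tendsto _).comp hD
  exact (hinner.const_mul 2).sub (hfrob.const_mul (2 * ν))

/-! ### The derivative of the adapted enstrophy on a window, and its uniform bound -/

variable {ν : ℝ}

/-- `|L‖ω‖²| = |2⟪ω, Du ω⟫ − 2ν|Dω|²| ≤ B + B² + |ν| B` from the enstrophy-density bounds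
(`L q = ∂ₜq + Dq·u − νΔq`, `opL_norm_curl_sq_eq`). [folklore] -/
theorem abs_opLDensity_le {S : Set ℝ} {u : ℝ → ℝ³ → ℝ³} {p : ℝ → ℝ³ → ℝ}
    (hcl : IsClassicalNSSolutionOn S ν 0 u p) (hS : UniqueDiffOn ℝ S) {B : ℝ}
    (hB : ∀ t ∈ S, ∀ x, |‖curl (u t) x‖ ^ 2| ≤ B ∧
      ‖fderiv ℝ (fun y => ‖curl (u t) y‖ ^ 2) x‖ ≤ B ∧
      |(Δ fun y => ‖curl (u t) y‖ ^ 2) x| ≤ B ∧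
      |timeDerivWithin S (fun s y => ‖curl (u s) y‖ ^ 2) t x| ≤ B ∧ ‖u t x‖ ≤ B)
    {t : ℝ} (ht : t ∈ S) (x : ℝ³) :
    |2 * ⟪curl (u t) x, fderiv ℝ (u t) x (curl (u t) x)⟫ -
        2 * ν * frobeniusNormSq (fderiv ℝ (curl (u t)) x)| ≤ B + B * B + |ν| * B := by
  rw [← opL_norm_curl_sq_eq hcl hS ht x]
  obtain ⟨-, h2, h3, h4, h5⟩ := hB t ht x
  have hB0 : 0 ≤ B := (norm_nonneg _).trans h5
  have ha : |fderiv ℝ (fun y => ‖curl (u t) y‖ ^ 2) x (u t x)| ≤ B * B := by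
    rw [← Real.norm_eq_abs]
    exact (ContinuousLinearMap.le_opNorm _ _).trans (mul_le_mul h2 h5 (norm_nonneg _) hB0)
  have hb : |ν * (Δ fun y => ‖curl (u t) y‖ ^ 2) x| ≤ |ν| * B := by
    rw [abs_mul]; exact mul_le_mul_of_nonneg_left h3 (abs_nonneg ν)
  calc |timeDerivWithin S (fun s y => ‖curl (u s) y‖ ^ 2) t x +
          fderiv ℝ (fun y => ‖curl (u t) y‖ ^ 2) x (u t x) -
          ν * (Δ fun y => ‖curl (u t) y‖ ^ 2) x|
      ≤ |timeDerivWithin S (fun s y => ‖curl (u s) y‖ ^ 2) t x| +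
          |fderiv ℝ (fun y => ‖curl (u t) y‖ ^ 2) x (u t x)| +
          |ν * (Δ fun y => ‖curl (u t) y‖ ^ 2) x| :=
        (abs_sub _ _).trans (add_le_add (abs_add_le _ _) le_rfl)
    _ ≤ B + B * B + |ν| * B := add_le_add (add_le_add h4 ha) hb

/-- **Differentiating the adapted enstrophy of a bounded classical solution against a dominated
adapted kernel.** On an open window `S = (a, b)`: if `(u, p)` is classical with the
enstrophy-density bounds `B`, and `G` is an adapted kernel of `u` on `S` dominated by an integrable
`Φ₀`, then `H = adaptedEnstrophy u G` has derivative `∫ (2⟪ω, Du ω⟫ − 2ν|Dω|²) G` at every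
`t ∈ S`. [folklore] -/
theorem hasDerivAt_adaptedEnstrophy_window {a b : ℝ} {u : ℝ → ℝ³ → ℝ³} {p : ℝ → ℝ³ → ℝ}
    (hcl : IsClassicalNSSolutionOn (Ioo a b) ν 0 u p) {T : ℝ} {x₀ : ℝ³} {G : ℝ → ℝ³ → ℝ}
    (hG : IsAdaptedBackwardKernel ν u (Ioo a b) T x₀ G) {Φ₀ : ℝ³ → ℝ}
    (hΦ₀ : Integrable Φ₀ (volume : Measure ℝ³)) (hdom : ∀ t ∈ Ioo a b, ∀ x, G t x ≤ Φ₀ x) {B : ℝ}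
    (hB : ∀ t ∈ Ioo a b, ∀ x, |‖curl (u t) x‖ ^ 2| ≤ B ∧
      ‖fderiv ℝ (fun y => ‖curl (u t) y‖ ^ 2) x‖ ≤ B ∧
      |(Δ fun y => ‖curl (u t) y‖ ^ 2) x| ≤ B ∧
      |timeDerivWithin (Ioo a b) (fun s y => ‖curl (u s) y‖ ^ 2) t x| ≤ B ∧ ‖u t x‖ ≤ B)
    {t : ℝ} (ht : t ∈ Ioo a b) :
    HasDerivAt (adaptedEnstrophy u G)
      (∫ x, (2 * ⟪curl (u t) x, fderiv ℝ (u t) x (curl (u t) x)⟫ -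
        2 * ν * frobeniusNormSq (fderiv ℝ (curl (u t)) x)) * G t x) t := by
  have hU : UniqueDiffOn ℝ (Ioo a b) := uniqueDiffOn_Ioo a b
  -- smoothness of the enstrophy density
  have hω := isSmoothSpaceTimeOn_vorticity_of_classical hcl hU
  have hq : IsSmoothSpaceTimeOn (Ioo a b) (fun s y => ‖curl (u s) y‖ ^ 2) := by
    have e : (fun s y => ‖curl (u s) y‖ ^ 2) = fun s y => ⟪vorticity u s y, vorticity u s y⟫ := by
      funext s y
      simp only [vorticity, real_inner_self_eq_norm_sq]
    rw [e]
    exact hω.inner hω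
  have h := hasDerivAt_integral_mul_kernel_of_bounds (ν := ν) (u := u) (S := Ioo a b) (G := G)
    (q := fun s y => ‖curl (u s) y‖ ^ 2) isOpen_Ioo hG.contDiffOn hG.adjoint_eq
    (fun s hs y => (hG.pos s hs y).le) hΦ₀ hdom hcl.smooth_velocity
    (fun s hs y => hcl.divFree s hs y) hq hB ht
  have e1 : (fun s => ∫ x, (fun s y => ‖curl (u s) y‖ ^ 2) s x * G s x) = adaptedEnstrophy u G := by
    funext s; rfl
  rw [e1] at h
  refine h.congr_deriv (integral_congr_ae (Eventually.of_forall fun x => ?_))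
  simp only
  rw [opL_norm_curl_sq_eq hcl hU ht x]

/-- The uniform bound `|H′(t)| ≤ B + B² + |ν|B` for the derivative of the previous lemma (the
kernel has unit mass). [folklore] -/
theorem abs_integral_opLDensity_mul_le {S : Set ℝ} {u : ℝ → ℝ³ → ℝ³} {p : ℝ → ℝ³ → ℝ}
    (hcl : IsClassicalNSSolutionOn S ν 0 u p) (hS : UniqueDiffOn ℝ S) {T : ℝ} {x₀ : ℝ³}
    {G : ℝ → ℝ³ → ℝ} (hG : IsAdaptedBackwardKernel ν u S T x₀ G) {B : ℝ}
    (hB : ∀ t ∈ S, ∀ x, |‖curl (u t) x‖ ^ 2| ≤ B ∧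
      ‖fderiv ℝ (fun y => ‖curl (u t) y‖ ^ 2) x‖ ≤ B ∧
      |(Δ fun y => ‖curl (u t) y‖ ^ 2) x| ≤ B ∧
      |timeDerivWithin S (fun s y => ‖curl (u s) y‖ ^ 2) t x| ≤ B ∧ ‖u t x‖ ≤ B)
    {t : ℝ} (ht : t ∈ S) :
    |∫ x, (2 * ⟪curl (u t) x, fderiv ℝ (u t) x (curl (u t) x)⟫ -
        2 * ν * frobeniusNormSq (fderiv ℝ (curl (u t)) x)) * G t x| ≤ B + B * B + |ν| * B := by
  have hint : Integrable (fun x => (B + B * B + |ν| * B) * G t x) (volume : Measure ℝ³) :=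
    (hG.integrable ht).const_mul _
  have hle : ∀ x, ‖(2 * ⟪curl (u t) x, fderiv ℝ (u t) x (curl (u t) x)⟫ -
      2 * ν * frobeniusNormSq (fderiv ℝ (curl (u t)) x)) * G t x‖ ≤ (B + B * B + |ν| * B) * G t x := by
    intro x
    rw [Real.norm_eq_abs, abs_mul, abs_of_nonneg (hG.pos t ht x).le]
    exact mul_le_mul_of_nonneg_right (abs_opLDensity_le hcl hS hB ht x) (hG.pos t ht x).le
  have h := norm_integral_le_of_norm_le hint (Eventually.of_forall hle)
  rw [Real.norm_eq_abs, integral_const_mul, hG.integral_eq_one t ht, mul_one] at h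
  exact h

/-! ### Dominated convergence for `H_k` and `H_k′` -/

/-- **`H_k(τ) → H̄(τ)`**: pointwise convergence of the velocity gradients and of the kernels,
a uniform bound on `‖curl w_k(τ)‖²` and one integrable function dominating the kernels give
convergence of the adapted enstrophies (dominated convergence). [folklore] -/
theorem tendsto_adaptedEnstrophy_of_tendsto {w : ℕ → ℝ → ℝ³ → ℝ³} {g : ℕ → ℝ → ℝ³ → ℝ}
    {W : ℝ → ℝ³ → ℝ³} {K : ℝ → ℝ³ → ℝ} {τ : ℝ} (hw : ∀ k, ContDiff ℝ 1 (w k τ))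
    (hgc : ∀ k, Continuous (g k τ)) {B : ℝ} (hB : ∀ k x, ‖curl (w k τ) x‖ ^ 2 ≤ B)
    {Φ₀ : ℝ³ → ℝ} (hΦ₀ : Integrable Φ₀ (volume : Measure ℝ³))
    (hdom : ∀ k x, 0 ≤ g k τ x ∧ g k τ x ≤ Φ₀ x)
    (h1 : ∀ x, Tendsto (fun k => fderiv ℝ (w k τ) x) atTop (𝓝 (fderiv ℝ (W τ) x)))
    (hgK : ∀ x, Tendsto (fun k => g k τ x) atTop (𝓝 (K τ x))) :
    Tendsto (fun k => adaptedEnstrophy (w k) (g k) τ) atTop (𝓝 (adaptedEnstrophy W K τ)) := by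
  simp only [adaptedEnstrophy]
  have hB0 : 0 ≤ B := (sq_nonneg _).trans (hB 0 0)
  refine tendsto_integral_of_dominated_convergence (fun x => B * Φ₀ x) (fun k => ?_)
    (hΦ₀.const_mul B) (fun k => Eventually.of_forall fun x => ?_) (Eventually.of_forall fun x => ?_)
  · have hc : Continuous (curl (w k τ)) :=
      (contDiff_curl (n := 0) (by exact_mod_cast hw k)).continuous
    exact ((hc.norm.pow 2).mul (hgc k)).aestronglyMeasurable
  · rw [Real.norm_eq_abs, abs_mul, abs_of_nonneg (sq_nonneg _), abs_of_nonneg (hdom k x).1]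
    exact mul_le_mul (hB k x) (hdom k x).2 (hdom k x).1 hB0
  · have hc : Tendsto (fun k => curl (w k τ) x) atTop (𝓝 (curl (W τ) x)) := by
      simp only [curl_eq_curlCLM]
      exact (curlCLM.continuous.tendsto _).comp (h1 x)
    exact ((hc.norm).pow 2).mul (hgK x)

/-- **`H_k′(τ) → ∫ (L q_W) K`**: the same for the derivative integrands
`(2⟪ω_k, Dw_k ω_k⟫ − 2ν|Dω_k|²) g_k`, which involve two derivatives of `w_k` only. [folklore] -/
theorem tendsto_integral_opLDensity_of_tendsto {w : ℕ → ℝ → ℝ³ → ℝ³} {g : ℕ → ℝ → ℝ³ → ℝ}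
    {W : ℝ → ℝ³ → ℝ³} {K : ℝ → ℝ³ → ℝ} {τ : ℝ} (hw : ∀ k, ContDiff ℝ 2 (w k τ))
    (hW : ContDiff ℝ 2 (W τ)) (hgc : ∀ k, Continuous (g k τ)) {B : ℝ}
    (hB : ∀ k x, |2 * ⟪curl (w k τ) x, fderiv ℝ (w k τ) x (curl (w k τ) x)⟫ -
      2 * ν * frobeniusNormSq (fderiv ℝ (curl (w k τ)) x)| ≤ B)
    {Φ₀ : ℝ³ → ℝ} (hΦ₀ : Integrable Φ₀ (volume : Measure ℝ³))
    (hdom : ∀ k x, 0 ≤ g k τ x ∧ g k τ x ≤ Φ₀ x)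
    (h1 : ∀ x, Tendsto (fun k => fderiv ℝ (w k τ) x) atTop (𝓝 (fderiv ℝ (W τ) x)))
    (h2 : ∀ x, Tendsto (fun k => fderiv ℝ (fderiv ℝ (w k τ)) x) atTop
      (𝓝 (fderiv ℝ (fderiv ℝ (W τ)) x)))
    (hgK : ∀ x, Tendsto (fun k => g k τ x) atTop (𝓝 (K τ x))) :
    Tendsto (fun k => ∫ x, (2 * ⟪curl (w k τ) x, fderiv ℝ (w k τ) x (curl (w k τ) x)⟫ -
        2 * ν * frobeniusNormSq (fderiv ℝ (curl (w k τ)) x)) * g k τ x) atTop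
      (𝓝 (∫ x, (2 * ⟪curl (W τ) x, fderiv ℝ (W τ) x (curl (W τ) x)⟫ -
        2 * ν * frobeniusNormSq (fderiv ℝ (curl (W τ)) x)) * K τ x)) := by
  have hB0 : 0 ≤ B := (abs_nonneg _).trans (hB 0 0)
  refine tendsto_integral_of_dominated_convergence (fun x => B * Φ₀ x) (fun k => ?_)
    (hΦ₀.const_mul B) (fun k => Eventually.of_forall fun x => ?_) (Eventually.of_forall fun x => ?_)
  · have hω1 : ContDiff ℝ 1 (curl (w k τ)) := contDiff_curl (n := 1) (by exact_mod_cast hw k)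
    have hc : Continuous (curl (w k τ)) := hω1.continuous
    have hD : Continuous (fderiv ℝ (w k τ)) := (hw k).continuous_fderiv two_ne_zero
    have hDω : Continuous (fderiv ℝ (curl (w k τ))) := hω1.continuous_fderiv one_ne_zero
    have happ : Continuous fun x => fderiv ℝ (w k τ) x (curl (w k τ) x) :=
      isBoundedBilinearMap_apply.continuous.comp (hD.prodMk hc)
    have hL : Continuous fun x => 2 * ⟪curl (w k τ) x, fderiv ℝ (w k τ) x (curl (w k τ) x)⟫ -
        2 * ν * frobeniusNormSq (fderiv ℝ (curl (w k τ)) x) :=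
      ((hc.inner happ).const_mul 2).sub ((continuous_frobeniusNormSq.comp hDω).const_mul (2 * ν))
    exact (hL.mul (hgc k)).aestronglyMeasurable
  · rw [Real.norm_eq_abs, abs_mul, abs_of_nonneg (hdom k x).1]
    exact mul_le_mul (hB k x) (hdom k x).2 (hdom k x).1 hB0
  · exact (tendsto_opLDensity hw hW (h1 x) (h2 x) ν).mul (hgK x)

/-! ### Continuity of the limit derivative `t ↦ ∫ (L q_W)(t) K(t)` -/

/-- For a jointly smooth field on an open time set, `t ↦ D(W t)(x)` and `t ↦ D²(W t)(x)` are
continuous on `S` for each fixed `x`. [folklore] -/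
theorem continuousOn_fderiv_slices {S : Set ℝ} (hS : IsOpen S) {W : ℝ → ℝ³ → ℝ³}
    (hW : IsSmoothSpaceTimeOn S W) (x : ℝ³) :
    ContinuousOn (fun t => fderiv ℝ (W t) x) S ∧
      ContinuousOn (fun t => fderiv ℝ (fderiv ℝ (W t)) x) S := by
  have hU : UniqueDiffOn ℝ S := hS.uniqueDiffOn
  have h1 : IsSmoothSpaceTimeOn S (fun t y => fderiv ℝ (W t) y) := hW.fderiv_slice hU
  have h2 : IsSmoothSpaceTimeOn S (fun t y => fderiv ℝ (fun z => fderiv ℝ (W t) z) y) :=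
    h1.fderiv_slice hU
  have hline : ∀ {F : Type} [NormedAddCommGroup F] [NormedSpace ℝ F] {Φ : ℝ → ℝ³ → F},
      IsSmoothSpaceTimeOn S Φ → ContinuousOn (fun t => Φ t x) S := by
    intro F _ _ Φ hΦ
    have hc : ContinuousOn (uncurry Φ) (S ×ˢ univ) := hΦ.continuousOn
    exact hc.comp (continuous_id.prodMk continuous_const).continuousOn
      (fun t ht => mk_mem_prod ht (mem_univ x))
  exact ⟨hline h1, hline h2⟩

/-- **Continuity of `t ↦ ∫ (2⟪ω_W, DW ω_W⟫ − 2ν|Dω_W|²)(t) K(t)` on an open window** where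
`DW`, `D²W` are bounded and `K` is dominated by one integrable function (parametric dominated
convergence). [folklore] -/
theorem continuousOn_integral_opLDensity {S : Set ℝ} (hS : IsOpen S) {W : ℝ → ℝ³ → ℝ³}
    (hW : IsSmoothSpaceTimeOn S W) {K : ℝ → ℝ³ → ℝ} (hK : ContDiffOn ℝ 2 (uncurry K) (S ×ˢ univ))
    (hK0 : ∀ t ∈ S, ∀ x, 0 ≤ K t x) {Φ₀ : ℝ³ → ℝ} (hΦ₀ : Integrable Φ₀ (volume : Measure ℝ³))
    (hdom : ∀ t ∈ S, ∀ x, K t x ≤ Φ₀ x) {M : ℝ}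
    (hM : ∀ t ∈ S, ∀ x, ‖fderiv ℝ (W t) x‖ ≤ M ∧ ‖fderiv ℝ (curl (W t)) x‖ ≤ M) :
    ContinuousOn (fun t => ∫ x, (2 * ⟪curl (W t) x, fderiv ℝ (W t) x (curl (W t) x)⟫ -
      2 * ν * frobeniusNormSq (fderiv ℝ (curl (W t)) x)) * K t x) S := by
  have hU : UniqueDiffOn ℝ S := hS.uniqueDiffOn
  have hW2 : ∀ t ∈ S, ContDiff ℝ 2 (W t) := fun t ht =>
    contDiff_infty.1 (hW.contDiff_slice ht) 2
  -- a uniform bound for the spatial expression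
  have hκ0 : 0 ≤ ‖curlCLM‖ := norm_nonneg curlCLM
  have hM0 : ∀ t ∈ S, 0 ≤ M := fun t ht => (norm_nonneg _).trans (hM t ht 0).1
  have hbdL : ∀ t ∈ S, ∀ x, |2 * ⟪curl (W t) x, fderiv ℝ (W t) x (curl (W t) x)⟫ -
      2 * ν * frobeniusNormSq (fderiv ℝ (curl (W t)) x)| ≤
        2 * ((‖curlCLM‖ * M) * (M * (‖curlCLM‖ * M))) + 2 * |ν| * (3 * M ^ 2) := by
    intro t ht x
    obtain ⟨hD, hDD⟩ := hM t ht x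
    have hm := hM0 t ht
    have hω : ‖curl (W t) x‖ ≤ ‖curlCLM‖ * M :=
      (norm_curl_le (W t) x).trans (mul_le_mul_of_nonneg_left hD hκ0)
    have hDω : ‖fderiv ℝ (curl (W t)) x‖ ≤ M := hDD
    have ha : |⟪curl (W t) x, fderiv ℝ (W t) x (curl (W t) x)⟫| ≤
        (‖curlCLM‖ * M) * (M * (‖curlCLM‖ * M)) := by
      refine (abs_real_inner_le_norm _ _).trans (mul_le_mul hω ?_ (norm_nonneg _) (by positivity))
      exact (ContinuousLinearMap.le_opNorm _ _).trans (mul_le_mul hD hω (norm_nonneg _) hm)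
    have hb : |frobeniusNormSq (fderiv ℝ (curl (W t)) x)| ≤ 3 * M ^ 2 := by
      rw [abs_of_nonneg (frobeniusNormSq_nonneg _)]
      refine (frobeniusNormSq_le_three_mul _).trans ?_
      have := pow_le_pow_left₀ (norm_nonneg _) hDω 2
      linarith
    calc |2 * ⟪curl (W t) x, fderiv ℝ (W t) x (curl (W t) x)⟫ -
            2 * ν * frobeniusNormSq (fderiv ℝ (curl (W t)) x)|
        ≤ |2 * ⟪curl (W t) x, fderiv ℝ (W t) x (curl (W t) x)⟫| +
            |2 * ν * frobeniusNormSq (fderiv ℝ (curl (W t)) x)| := abs_sub _ _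
      _ = 2 * |⟪curl (W t) x, fderiv ℝ (W t) x (curl (W t) x)⟫| +
            2 * |ν| * |frobeniusNormSq (fderiv ℝ (curl (W t)) x)| := by
          rw [abs_mul, abs_mul, abs_mul, abs_of_pos (two_pos : (0:ℝ) < 2)]
      _ ≤ _ := by gcongr
  set BW : ℝ := 2 * ((‖curlCLM‖ * M) * (M * (‖curlCLM‖ * M))) + 2 * |ν| * (3 * M ^ 2)
    with hBW
  refine continuousOn_of_dominated (bound := fun x => BW * Φ₀ x) (fun t ht => ?_) (fun t ht => ?_)
    (hΦ₀.const_mul BW) (Eventually.of_forall fun x => ?_)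
  · -- measurability of each slice (continuity in `x`)
    have hω1 : ContDiff ℝ 1 (curl (W t)) := contDiff_curl (n := 1) (by exact_mod_cast hW2 t ht)
    have hc : Continuous (curl (W t)) := hω1.continuous
    have hD : Continuous (fderiv ℝ (W t)) := (hW2 t ht).continuous_fderiv two_ne_zero
    have hDω : Continuous (fderiv ℝ (curl (W t))) := hω1.continuous_fderiv one_ne_zero
    have happ : Continuous fun x => fderiv ℝ (W t) x (curl (W t) x) :=
      isBoundedBilinearMap_apply.continuous.comp (hD.prodMk hc)
    have hL : Continuous fun x => 2 * ⟪curl (W t) x, fderiv ℝ (W t) x (curl (W t) x)⟫ -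
        2 * ν * frobeniusNormSq (fderiv ℝ (curl (W t)) x) :=
      ((hc.inner happ).const_mul 2).sub ((continuous_frobeniusNormSq.comp hDω).const_mul (2 * ν))
    have hKc : Continuous (K t) := continuous_slice_of_continuousOn_prod_univ hK.continuousOn ht
    exact (hL.mul hKc).aestronglyMeasurable
  · -- domination
    refine Eventually.of_forall fun x => ?_
    rw [Real.norm_eq_abs, abs_mul, abs_of_nonneg (hK0 t ht x)]
    have hBW0 : 0 ≤ BW := (abs_nonneg _).trans (hbdL t ht x)
    exact mul_le_mul (hbdL t ht x) (hdom t ht x) (hK0 t ht x) hBW0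
  · -- continuity in `t` for fixed `x`
    obtain ⟨hD, hDD⟩ := continuousOn_fderiv_slices hS hW x
    have hc : ContinuousOn (fun t => curl (W t) x) S := by
      simp only [curl_eq_curlCLM]
      exact curlCLM.continuous.comp_continuousOn hD
    have happ : ContinuousOn (fun t => fderiv ℝ (W t) x (curl (W t) x)) S :=
      isBoundedBilinearMap_apply.continuous.comp_continuousOn (hD.prodMk hc)
    have hDω : ContinuousOn (fun t => fderiv ℝ (curl (W t)) x) S := by
      have e : ∀ t ∈ S, fderiv ℝ (curl (W t)) x = curlCLM.comp (fderiv ℝ (fderiv ℝ (W t)) x) :=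
        fun t ht => fderiv_curl (hW2 t ht) x
      refine ContinuousOn.congr ?_ e
      exact ((ContinuousLinearMap.compL ℝ ℝ³ (ℝ³ →L[ℝ] ℝ³) ℝ³) curlCLM).continuous.comp_continuousOn hDD
    have hL : ContinuousOn (fun t => 2 * ⟪curl (W t) x, fderiv ℝ (W t) x (curl (W t) x)⟫ -
        2 * ν * frobeniusNormSq (fderiv ℝ (curl (W t)) x)) S :=
      ((hc.inner happ).const_mul 2).sub
        ((continuous_frobeniusNormSq.comp_continuousOn hDω).const_mul (2 * ν))
    have hKc : ContinuousOn (fun t => K t x) S :=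
      hK.continuousOn.comp (continuous_id.prodMk continuous_const).continuousOn
        (fun t ht => mk_mem_prod ht (mem_univ x))
    exact hL.mul hKc

end Summit.NavierStokesRegularity.NavierStokesRegularity.Theorems

end
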